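/-
COR-CM (cell pub-hodgecm2, stage 2 of the Hodge ladder) — count-neutral KERNEL COMBINATORICS «the index-two cyclic law» (modular ∪ semidihedral
columns), part X: THE TWIST-FREE PACKAGING — the datum from `(u, w)` alone and the law with the hypothesis `c ∈ ⟨(w·u)²⟩` (seat
prover-pub-hodgecm2-b23-g49-0, binder prover b23, gen 49; claim «INDEX-TWO CYCLIC LAW», HOME/INBOX.md l.22678; addendum to the LANE RECORD l.22835).
Theorems only, on parts I, V, VI, IX; no `decide`, no certificate, no named fact, no `sorry`; `Interfaces.lean` (C1), every E term, B01, `Transposition/*`,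
`PortJoin/*`, `D2Bridge/*` untouched.
HONEST FRAMING: `HC_CM` is NOT proved, here or anywhere in the tree; nothing here is a period, a count of record or a headline.
T5: n/a-class (hypothesis binders: `uⁿ = c`, `orderOf u = 2n`, `[⟨u⟩ : G] = 2`, `w ∉ ⟨u⟩`, `w·w = 1`, `c·c = 1`, `c ≠ 1`, `Even n`, `c ∈ ⟨(w·u)²⟩` — inhabited by
part VIIʼs semidirect products; checker: self).
-/
import Summits.HodgeConjecture.CorCM.Census.IndexTwoCyclicDichotomy

/-!
# The index-two cyclic law, X: twist-free packaging — `μ(G, c) = β − 1 = φ₂` from `u`, `w` and `c ∈ ⟨(w·u)²⟩`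

The twisting exponent `r` of an index-two cyclic datum is determined by `u` and `w` (`w·u·w ∈ ⟨u⟩` since `[⟨u⟩ : G] = 2`), and the twist hypothesis
`c ∈ ⟨u^{r+1}⟩` of part VI reads `c ∈ ⟨(w·u)²⟩` because `(w·u)² = w·u·w·u = uʳ·u`.  So the law needs no structure at all:

* §1 `exists_datum_of_involution`: `uⁿ = c`, `orderOf u = 2n`, `[⟨u⟩ : G] = 2`, `w ∉ ⟨u⟩`, `w·w = 1` ⟹ a datum with these `u`, `w`.
* §2 `w_mul_u_sq : (w·u)² = u^{r+1}`; the laws of parts VI/IX with the hypothesis `c ∈ ⟨(w·u)²⟩` (`…_of_sq`).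
* §3 **`isLeast_card_gfaces_generate_of_involution`**: for EVERY finite group `G`, every `u, w` as in §1 with `n` even and `c = uⁿ ∈ ⟨(w·u)²⟩`, the least
  number of rank-four face relations whose base changes generate the integer Hodge lattice of `(G, c)` modulo the pairs is EXACTLY `β − 1 = φ₂`
  (`…_fibreTwo_of_involution`); without the last two hypotheses `μ ≤ β − 1` (`exists_gfaces_generate_of_involution`); and the dichotomy
  `d₂ = 1 ↔ c ∈ ⟨(w·u)²⟩` (`indexTwoRank_stabGen_eq_one_iff_of_involution`).

## References
* [Pohlmann1968] H. Pohlmann, Algebraic cycles on abelian varieties of complex multiplication type, Ann. of Math. 88 (1968), Thm 1.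
* [Milne1999] J. S. Milne, Lefschetz motives and the Tate conjecture, Compositio Math. 117 (1999), Prop. 2.1, p. 54.
-/

namespace Summit.HodgeConjecture.CorCM.Census.IndexTwoCyclic

open Finset
open Summit.HodgeConjecture.CorCM.Prior.AllgGroup.RfwfAllgGroup
open Summit.HodgeConjecture.CorCM.Census.BlockParity
open Summit.HodgeConjecture.CorCM.Census.Coinvariant
open Summit.HodgeConjecture.CorCM.Census.TypeStabiliser
open Summit.HodgeConjecture.CorCM.Census.IndexTwo

noncomputable section

variable {G : Type*} [Group G] [Fintype G] [DecidableEq G] {c : G} {n : ℕ} [NeZero n]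

/-! ## §1 The datum from `u` and `w` alone -/

omit [Fintype G] [DecidableEq G] in
/-- **The index-two cyclic datum from `(u, w)`**: the twisting exponent exists because `w·u·w ∈ ⟨u⟩` (index two). [folklore] -/
theorem exists_datum_of_involution (u w : G) (hun : u ^ n = c) (hord : orderOf u = 2 * n) (hindex : (Subgroup.zpowers u).index = 2)
    (hw : w ∉ Subgroup.zpowers u) (hww : w * w = 1) : ∃ D : Datum G c n, D.u = u ∧ D.w = w := by
  have hu : u ∈ Subgroup.zpowers u := Subgroup.mem_zpowers u
  have hwu : w * u ∉ Subgroup.zpowers u := by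
    rw [Subgroup.mul_mem_iff_of_index_two hindex]
    exact fun h => hw (h.mpr hu)
  have hwuw : w * u * w ∈ Subgroup.zpowers u := by
    rw [Subgroup.mul_mem_iff_of_index_two hindex]
    exact ⟨fun h => absurd h hwu, fun h => absurd h hw⟩
  obtain ⟨k, hk⟩ := Subgroup.mem_zpowers_iff.mp hwuw
  have hn : 1 ≤ n := Nat.one_le_iff_ne_zero.mpr (NeZero.ne n)
  have hmod : 0 ≤ k % (2 * n : ℕ) := Int.emod_nonneg _ (by exact_mod_cast (show 2 * n ≠ 0 by omega))
  set r : ℕ := (k % (2 * n : ℕ)).toNat with hrdef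
  have hr : u ^ r = w * u * w := by
    rw [← hk, ← zpow_natCast, hrdef, Int.toNat_of_nonneg hmod, ← hord, zpow_mod_orderOf]
  refine ⟨⟨u, w, r, hun, hord, hindex, hw, hww, ?_⟩, rfl, rfl⟩
  rw [hr, mul_assoc (w * u), hww, mul_one]

/-! ## §2 The square of the product `w·u` -/

variable (D : Datum G c n)

omit [Fintype G] [DecidableEq G] [NeZero n] in
/-- **`(w·u)² = u^{r+1}`.** [folklore] -/
theorem w_mul_u_sq : (D.w * D.u) ^ 2 = D.u ^ (D.r + 1) := by
  rw [pow_two, show D.w * D.u * (D.w * D.u) = (D.w * D.u ^ 1 * D.w) * D.u by rw [pow_one]; group, D.w_mul_pow_mul_w, mul_one,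
    ← pow_succ]

include D in
/-- **THE LAW with the hypothesis `c ∈ ⟨(w·u)²⟩`** (`n` even): `μ = β − 1`. [folklore] -/
theorem isLeast_card_gfaces_generate_of_sq (hc2 : c * c = 1) (hc1 : c ≠ 1) (hn : Even n) (h : c ∈ Subgroup.zpowers ((D.w * D.u) ^ 2)) :
    IsLeast {m : ℕ | ∃ S : Finset (CMF G c →₀ ℤ), ↑S ⊆ gfaceSet G c hc2 ∧ S.card = m ∧
      hodgeSpan c hc2 ≤ Submodule.span ℤ (pairSet c) ⊔ Submodule.span ℤ (translates c S)} (Fintype.card (Block c) - 1) := by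
  rw [w_mul_u_sq] at h
  exact isLeast_card_gfaces_generate_of_twist D hc2 hc1 hn h

include D in
/-- **`μ = φ₂` with the hypothesis `c ∈ ⟨(w·u)²⟩`.** [folklore] -/
theorem isLeast_card_gfaces_generate_fibreTwo_of_sq (hc2 : c * c = 1) (hc1 : c ≠ 1) (hn : Even n)
    (h : c ∈ Subgroup.zpowers ((D.w * D.u) ^ 2)) :
    IsLeast {m : ℕ | ∃ S : Finset (CMF G c →₀ ℤ), ↑S ⊆ gfaceSet G c hc2 ∧ S.card = m ∧
      hodgeSpan c hc2 ≤ Submodule.span ℤ (pairSet c) ⊔ Submodule.span ℤ (translates c S)} (fibreTwo c hc2) := by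
  rw [w_mul_u_sq] at h
  exact isLeast_card_gfaces_generate_fibreTwo_of_twist D hc2 hc1 hn h

include D in
/-- **The dichotomy with `(w·u)²`** (`n` even): `d₂(G/𝒦) = 1 ↔ c ∈ ⟨(w·u)²⟩`. [folklore] -/
theorem indexTwoRank_stabGen_eq_one_iff_sq (hc2 : c * c = 1) (hc1 : c ≠ 1) (hn : Even n) :
    indexTwoRank (stabGen c) = 1 ↔ c ∈ Subgroup.zpowers ((D.w * D.u) ^ 2) := by
  rw [w_mul_u_sq]
  exact indexTwoRank_stabGen_eq_one_iff D hc2 hc1 hn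

include D in
/-- **`β − φ₂ ∈ {1, 2}` read off `(w·u)²`** (`n` even). [folklore] -/
theorem card_block_eq_fibreTwo_add_of_sq (hc2 : c * c = 1) (hc1 : c ≠ 1) (hn : Even n) :
    Fintype.card (Block c) = fibreTwo c hc2 + (if c ∈ Subgroup.zpowers ((D.w * D.u) ^ 2) then 1 else 2) := by
  rw [w_mul_u_sq]
  exact card_block_eq_fibreTwo_add D hc2 hc1 hn

/-! ## §3 Structure-free statements -/

/-- **`μ ≤ β − 1` for every index-two cyclic `(G ⊃ ⟨u⟩ ∋ c = uⁿ, w)`, structure-free.** [folklore] -/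
theorem exists_gfaces_generate_of_involution (u w : G) (hun : u ^ n = c) (hord : orderOf u = 2 * n) (hindex : (Subgroup.zpowers u).index = 2)
    (hw : w ∉ Subgroup.zpowers u) (hww : w * w = 1) (hc2 : c * c = 1) :
    ∃ S : Finset (CMF G c →₀ ℤ), (↑S ⊆ gfaceSet G c hc2) ∧ S.card + 1 ≤ Fintype.card (Block c) ∧
      hodgeSpan c hc2 ≤ Submodule.span ℤ (pairSet c) ⊔ Submodule.span ℤ (translates c S) := by
  obtain ⟨D, -, -⟩ := exists_datum_of_involution u w hun hord hindex hw hww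
  exact exists_gfaces_generate D hc2

/-- **THE INDEX-TWO CYCLIC LAW, structure-free**: `u` of order `2n` with `uⁿ = c` generating a subgroup of index two, an involution `w` outside it,
`n` even and `c ∈ ⟨(w·u)²⟩` (modular, semidihedral, … twists) ⟹ `μ(G, c) = β(G, c) − 1`. [folklore] -/
theorem isLeast_card_gfaces_generate_of_involution (u w : G) (hun : u ^ n = c) (hord : orderOf u = 2 * n)
    (hindex : (Subgroup.zpowers u).index = 2) (hw : w ∉ Subgroup.zpowers u) (hww : w * w = 1) (hc2 : c * c = 1) (hc1 : c ≠ 1) (hn : Even n)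
    (h : c ∈ Subgroup.zpowers ((w * u) ^ 2)) :
    IsLeast {m : ℕ | ∃ S : Finset (CMF G c →₀ ℤ), ↑S ⊆ gfaceSet G c hc2 ∧ S.card = m ∧
      hodgeSpan c hc2 ≤ Submodule.span ℤ (pairSet c) ⊔ Submodule.span ℤ (translates c S)} (Fintype.card (Block c) - 1) := by
  obtain ⟨D, hu, hwD⟩ := exists_datum_of_involution u w hun hord hindex hw hww
  subst hu hwD
  exact isLeast_card_gfaces_generate_of_sq D hc2 hc1 hn h

/-- **`μ = φ₂`, structure-free.** [folklore] -/
theorem isLeast_card_gfaces_generate_fibreTwo_of_involution (u w : G) (hun : u ^ n = c) (hord : orderOf u = 2 * n)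
    (hindex : (Subgroup.zpowers u).index = 2) (hw : w ∉ Subgroup.zpowers u) (hww : w * w = 1) (hc2 : c * c = 1) (hc1 : c ≠ 1) (hn : Even n)
    (h : c ∈ Subgroup.zpowers ((w * u) ^ 2)) :
    IsLeast {m : ℕ | ∃ S : Finset (CMF G c →₀ ℤ), ↑S ⊆ gfaceSet G c hc2 ∧ S.card = m ∧
      hodgeSpan c hc2 ≤ Submodule.span ℤ (pairSet c) ⊔ Submodule.span ℤ (translates c S)} (fibreTwo c hc2) := by
  obtain ⟨D, hu, hwD⟩ := exists_datum_of_involution u w hun hord hindex hw hww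
  subst hu hwD
  exact isLeast_card_gfaces_generate_fibreTwo_of_sq D hc2 hc1 hn h

/-- **The dichotomy, structure-free** (`n` even): `d₂(G/𝒦) = 1 ↔ c ∈ ⟨(w·u)²⟩`. [folklore] -/
theorem indexTwoRank_stabGen_eq_one_iff_of_involution (u w : G) (hun : u ^ n = c) (hord : orderOf u = 2 * n)
    (hindex : (Subgroup.zpowers u).index = 2) (hw : w ∉ Subgroup.zpowers u) (hww : w * w = 1) (hc2 : c * c = 1) (hc1 : c ≠ 1) (hn : Even n) :
    indexTwoRank (stabGen c) = 1 ↔ c ∈ Subgroup.zpowers ((w * u) ^ 2) := by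
  obtain ⟨D, hu, hwD⟩ := exists_datum_of_involution u w hun hord hindex hw hww
  subst hu hwD
  exact indexTwoRank_stabGen_eq_one_iff_sq D hc2 hc1 hn

/-- **`β = φ₂ + (1 or 2)`, structure-free** (`n` even). [folklore] -/
theorem card_block_eq_fibreTwo_add_of_involution (u w : G) (hun : u ^ n = c) (hord : orderOf u = 2 * n)
    (hindex : (Subgroup.zpowers u).index = 2) (hw : w ∉ Subgroup.zpowers u) (hww : w * w = 1) (hc2 : c * c = 1) (hc1 : c ≠ 1) (hn : Even n) :
    Fintype.card (Block c) = fibreTwo c hc2 + (if c ∈ Subgroup.zpowers ((w * u) ^ 2) then 1 else 2) := by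
  obtain ⟨D, hu, hwD⟩ := exists_datum_of_involution u w hun hord hindex hw hww
  subst hu hwD
  exact card_block_eq_fibreTwo_add_of_sq D hc2 hc1 hn

end

end Summit.HodgeConjecture.CorCM.Census.IndexTwoCyclic
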